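import Summits.AnomalousDissipation.AnomalousDissipation.Theorems.SolenoidalFractalHomogenisationLagrangianStepSidebandXGenFrame
import Summits.AnomalousDissipation.AnomalousDissipation.Theorems.SolenoidalFractalHomogenisationLagrangianStepCellChainFastSlavingFrame
import Summits.AnomalousDissipation.AnomalousDissipation.Theorems.SolenoidalFractalHomogenisationLagrangianStepSidebandXApriori
import HarnessLib

/-!
# K1L_D `LagrangianRenormalisationStepDesign` (stmt-AnomalousDissipation-27980), registered stub `stub_D1_V0thg` (v28, ruling D28-3 (3)), port-map layer L5:
# THE SLOW MODE AND THE BOX VECTOR OF THE FROZEN-FRAME SOLUTION ARE BOUNDED BY THE ENERGY AT EVERY TIME (helper; `--supports stmt-AnomalousDissipation-27980 --as helper`)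

Summits-side helper file of route `SolenoidalFractalHomogenisation` (prover seat `ad-k1l-cellLawV-w1` g9; port map
`Cruxes/LagrangianRenormalisationStepDesign/Lines/onelevel-vtheta-twist-portmap.md` §3 L5, ruling D28-7).  The frozen-frame twin of `…SidebandXApriori`
(`classFreq_injective`, `classFreq_ne_self` are flat, REUSED BY NAME).  Everything proved; no definitions, no named facts, no sorry.
* `norm_sq_sbVecθ_eq_sum` — `‖Z t‖² = Σ_{k ∈ classFreq n ℓ '' box} ‖modeRepθ k t‖²`;
* **`norm_sq_slow_add_sbVecθ_le`** — `‖x t‖² + ‖Z t‖² ≤ E t` for every `t ∈ [0,T]` (`norm_sq_le_fastEnergy_frame`).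
At `G₀ = 1` these are the flat statements.
NOT a proof of any registered stub, of the crux, or of anomalous dissipation; rung F-D1 infrastructure for the `stub_D1_V0thg` engine.
-/

set_option linter.dupNamespace false

noncomputable section

namespace Summit.AnomalousDissipation.AnomalousDissipation.Theorems.SolenoidalFractalHomogenisation.LagrangianStep.Sideband

open Set MeasureTheory Complex UnitAddTorus
open scoped InnerProductSpace
open Literature.Analysis Literature.Analysis.FunctionSpaces Literature.Analysis.FunctionSpaces.Torus
open Literature.Analysis.FluidPDE Literature.Analysis.FluidPDE.Torus Literature.Analysis.FluidPDE.LatticeShear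
open Summit.AnomalousDissipation.AnomalousDissipation.Theorems.SolenoidalFractalHomogenisation.LagrangianStep.CellChain (modeRepθ norm_sq_le_fastEnergy_frame)

variable {k₀ : ℕ}

/-- `‖Z t‖² = Σ_{k ∈ classFreq n ℓ '' box} ‖modeRep k t‖²`. [cite: MajdaKramer1999, §2.2.1.3] -/
theorem norm_sq_sbVecθ_eq_sum (W₁ : LatticeWord k₀) {n : ℕ} (hn : n ≠ 0) (𝔹 : Torus.Visc4 (Fin 3)) (G₀ : Matrix (Fin 3) (Fin 3) ℝ)
    (F : UnitAddTorus (Fin 3) → EuclideanSpace ℝ (Fin 3)) (u : ℝ → UnitAddTorus (Fin 3) → EuclideanSpace ℝ (Fin 3)) (ℓ : Fin 3 → ℤ) (R : ℕ) (t : ℝ) :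
    ‖sbVecθ W₁ n 𝔹 G₀ F u ℓ R t‖ ^ 2 = ∑ k ∈ (box R).image (classFreq n ℓ), ‖modeRepθ W₁ n 𝔹 G₀ F u k t‖ ^ 2 := by
  classical
  rw [PiLp.norm_sq_eq_of_L2, Finset.sum_image (fun z _ z' _ h => classFreq_injective hn ℓ h)]
  rw [← Finset.sum_coe_sort (box R)]
  exact Finset.sum_congr rfl fun z _ => by rw [sbVecθ_apply]

/-- **A PRIORI BOUND**: with the energy representative `E` of `CellChain.exists_energyRep_cell` (continuous on `[0,T]`, `E t = ‖u t‖²` a.e.),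
`‖x t‖² + ‖Z t‖² ≤ E t` for EVERY `t ∈ [0,T]` (`n ≥ 1`). [cite: Temam1984, Ch. III §1 Lemma 1.2 (energy inequality)] -/
theorem norm_sq_slow_add_sbVecθ_le (W₁ : LatticeWord k₀) {n : ℕ} (hn : n ≠ 0) {T : ℝ} (hT : 0 < T) {𝔹 : Torus.Visc4 (Fin 3)} {G₀ : Matrix (Fin 3) (Fin 3) ℝ}
    {F : UnitAddTorus (Fin 3) → EuclideanSpace ℝ (Fin 3)} {u : ℝ → UnitAddTorus (Fin 3) → EuclideanSpace ℝ (Fin 3)}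
    (h : Torus.IsWeakTensorPassiveVectorDistortedOn 0 T 𝔹 (W₁.cell n) (fun _ _ => G₀) F u) (hF : Integrable F volume)
    {E : ℝ → ℝ} (hEc : ContinuousOn E (Icc 0 T)) (hE : ∀ᵐ t ∂(volume.restrict (Ioo 0 T)), E t = ∫ x, ‖u t x‖ ^ 2)
    (ℓ : Fin 3 → ℤ) (R : ℕ) {t : ℝ} (ht : t ∈ Icc 0 T) :
    ‖modeRepθ W₁ n 𝔹 G₀ F u ℓ t‖ ^ 2 + ‖sbVecθ W₁ n 𝔹 G₀ F u ℓ R t‖ ^ 2 ≤ E t := by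
  classical
  have hnot : ℓ ∉ (box R).image (classFreq n ℓ) := by
    intro hmem
    obtain ⟨z, hz, hzℓ⟩ := Finset.mem_image.1 hmem
    exact classFreq_ne_self hn ℓ ⟨z, hz⟩ hzℓ
  have hmain := norm_sq_le_fastEnergy_frame W₁ n hT h hF hEc hE ((box R).image (classFreq n ℓ)) hnot t ht
  rw [norm_sq_sbVecθ_eq_sum W₁ hn 𝔹 G₀ F u ℓ R t]
  linarith

end Summit.AnomalousDissipation.AnomalousDissipation.Theorems.SolenoidalFractalHomogenisation.LagrangianStep.Sideband

end
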